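import Summits.QuantumFields.BalabanUV.T4Continuum.Support.BlockPairingFaces
import Summits.QuantumFields.BalabanUV.T4Continuum.Spine.NE2PerturbedLayer

/-!
# T⁴ programme, spine node NE2 (U1a) — THE FIRST BACKGROUND-DEPENDENT η-RATE: a FIRST-ORDER (minimal-coupling) perturbation
# `Δ_a + t·Σ_μ 𝒜_μ∇_μ` of Bałaban's free vector operator by a LIPSCHITZ connection `𝒜` sampled at every lattice spacing —
# `PerturbationLaws` DISCHARGED from smoothness alone, the unit-lattice covariance converges with rate `L^{−k}`

Ninth generation of the NE2 prover lineage P1 of the cell `pub-balaban`, file 7 (on top of files 6/6b `Support/BlockPairingGeometry`, `Support/BlockPairingFaces` and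
file 4 `Spine/NE2PerturbedLayer`).  The resolvent route reduced NE2⁺ to the two typed inequalities (H-bd)/(H-cons) of
`BackgroundResolventTower.PerturbationLaws`.  This file discharges them for the first DERIVATIVE-type perturbation family — the
shape in which a background gauge field enters a covariant Laplacian at first order («minimal coupling» `Δ_U = Δ + i(𝒜·∇ + ∇·𝒜) +
O(𝒜²)`): at level `k` (spacing `η_k = L^{−k}`), `P_k = Σ_μ diag(𝒜^{(k)}_μ)·∇^{(k)}_μ` (`firstOrder`), where the coefficient fields
`𝒜^{(k)}_μ : T_{η_k} × {1..d} → ℂ` are ANY family with (`LipschitzBackground`)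
 (i) `|𝒜^{(k)}_μ(x)| ≤ α` (size), (ii) `|𝒜^{(k)}_μ(x + η_ke_ν) − 𝒜^{(k)}_μ(x)| ≤ β·η_k` (Lipschitz at its own spacing),
 (iii) `|𝒜^{(k+1)}_μ(x′) − 𝒜^{(k)}_μ(par x′)| ≤ β·η_k` (two-spacing consistency: the finer sample against the coarser one at the
 block parent) — e.g. the samples of ONE Lipschitz connection on the unit torus at all spacings.  THEN:
 * §1–§2 (H-bd): `‖P𝒢‖ ≤ d·α·Cst` ((1.89) `‖∇𝒢‖ ≤ Cst`) and `‖𝒢P‖ ≤ d(α + β)Cst` (adjoint + discrete Leibniz + `∇ᴴ = −Sᴴ∇`);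
 * §3 (H-cons): **`opNorm_consistency_le`** `‖𝒢′(P′J − JP)𝒢‖ ≤ d·Cst²·(Rδ + 2d(R + 1)α·η)` from the EXACT decomposition
   `D′∇′J − JD∇ = R·(D′ − D̄)F J∇ + (1 − Π)(R·F − 1)J D∇` (`D̄ = diag(𝒜 ∘ par)`; file 6: `∇′J = R·FJ∇`, `JD = D̄J`, `Π(R·F − 1)J = 0`)
   and the complement defect `‖𝒢′(1 − Π)‖ ≤ 2dCst·η` (file 3): the block-oscillating part of the fine derivative of a block-constant
   field is invisible to the fine propagator up to `O(η)`;
 * §4 **`perturbationLaws_firstOrder`**: `PerturbationLaws (calDalev L M a ha) (Pmodel V) (JpcT L M) (d(α+β)Cst) (C₂·L^{−k})`,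
   `C₂ = d·Cst²·(Lβ + 2d(L + 1)α)`; **`towerLimitRate_firstOrderBackground`** (`L ≥ 2`, `d ≥ 1`, `‖t‖·d(α+β)Cst < 1`): the King-averaged
   unit-lattice covariance of `(Δ_a^{(k)} + t·P_k)⁻¹` CONVERGES with rate `L^{−k}` and the explicit constant of
   `NE2PerturbedLayer.towerLimitRate_perturbed_king`; **`firstOrderBackground_limit`** adds the Lipschitz bound in `t`.  NO typed residual.

HONEST FRAMING (T4-DAG p. 1).  A MODEL of the background dependence, not Bałaban's `Δ_a(U)`: abelian-type first-order minimal
coupling with a globally small (`‖t‖·d(α+β)Cst < 1`) Lipschitz coefficient, King's (non-covariant) outer averaging, no `O(𝒜²)` /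
`∂_UP_U∂_U*` / `aQ(U)*Q(U)` terms, operator norm on a fixed finite torus; it is the FIRST η-rate in the tree in which a background
enters the propagator at all, and it shows that (H-bd)/(H-cons) follow from smoothness of the background alone.  Rates / pairing /
constants OURS; nothing printed is a hypothesis; NOT infinite volume / mass gap / Clay / summit progress; spine 0/9 unchanged.
HONEST DEPENDENCY: continuum YM on T⁴ ⇐ BetaPertH ∧ nine spine estimates (0/9 proved); BetaPertH ⇐ (D1) ∧ (D4) ∧ CAP+tail;
G-an2-4 gates asym, D1 and NE2/3/4.  ABSOLUTE RULE kept; no `sorry`.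
-/

noncomputable section

open scoped BigOperators ComplexConjugate Matrix Matrix.Norms.L2Operator
open Filter Topology

namespace Summit.QuantumFields.BalabanUV.T4Continuum.FirstOrderBackgroundModel

open Literature.MathematicalPhysics.QuantumFieldTheory.Balaban1983to89.B5Prop11Plancherel
open Literature.MathematicalPhysics.QuantumFieldTheory.Balaban1983to89.B5G183RateUnitTower (lev lev_neZero)
open Summit.QuantumFields.BalabanUV.T4Continuum
open Summit.QuantumFields.BalabanUV.T4Continuum.CovariantAveragingTower (TowerLimitRate)
open Summit.QuantumFields.BalabanUV.T4Continuum.BalabanAveragedTowerUnit (idx Qlev calGlev one_le_lev' cast_lev')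
open Summit.QuantumFields.BalabanUV.T4Continuum.BackgroundResolventTower
open Summit.QuantumFields.BalabanUV.T4Continuum.BalabanBlockPoincare (Pi)
open Summit.QuantumFields.BalabanUV.T4Continuum.KingPairingPlantedLaw
open Summit.QuantumFields.BalabanUV.T4Continuum.BlockPairingGeometry
open Summit.QuantumFields.BalabanUV.T4Continuum.BlockPairingFaces
open Summit.QuantumFields.BalabanUV.T4Continuum.NE2PerturbedLayer

variable {d : ℕ}

/-! ## §1 The first-order perturbation and its right bound -/

section OneLevel

variable (Nf : Fin d → ℕ) [hNf : ∀ μ, NeZero (Nf μ)]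

/-- **THE FIRST-ORDER (MINIMAL-COUPLING) PERTURBATION** with coefficient fields `W_μ` and lattice factor `c = η⁻¹`:
`P = Σ_μ diag(W_μ)·∇^c_μ`. [folklore] -/
def firstOrder (c : ℂ) (W : Fin d → (Tor Nf × Fin d → ℂ)) : Matrix (Tor Nf × Fin d) (Tor Nf × Fin d) ℂ :=
  ∑ μ, Matrix.diagonal (W μ) * fdiff Nf c μ

end OneLevel

section Level

variable (n : ℕ) [NeZero n] (hn : 1 ≤ n) (M : Fin d → ℕ) [hM : ∀ μ, NeZero (M μ)] (a : ℝ) (ha : 0 < a)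

/-- **(H-bd), right**: `‖P·𝒢‖ ≤ d·α·Cst` from `|W| ≤ α` and (1.89) `‖∇_μ𝒢‖ ≤ Cst`. [cite: Balaban1984PropagatorsI, Prop. 1.1 (1.89) p.33]
[folklore] -/
theorem opNorm_firstOrder_mul_calG_le {W : Fin d → (Tor (fine n M) × Fin d → ℂ)} {α : ℝ} (hα : 0 ≤ α)
    (hW : ∀ μ i, ‖W μ i‖ ≤ α) : ‖firstOrder (fine n M) ((n : ℕ) : ℂ) W * calG n hn M a ha‖ ≤ d * α * Cst d a := by
  rw [firstOrder, Finset.sum_mul]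
  refine (norm_sum_le _ _).trans ?_
  have hC := Cst_nonneg d a
  have hterm : ∀ μ ∈ Finset.univ, ‖Matrix.diagonal (W μ) * fdiff (fine n M) ((n : ℕ) : ℂ) μ * calG n hn M a ha‖ ≤ α * Cst d a := by
    intro μ _
    rw [Matrix.mul_assoc]
    exact (Matrix.l2_opNorm_mul _ _).trans (mul_le_mul (opNorm_diagonal_le _ hα (hW μ)) (opNorm_fdiff_calG_le n hn M a ha μ)
      (norm_nonneg _) hα)
  refine (Finset.sum_le_sum hterm).trans (le_of_eq ?_)
  rw [Finset.sum_const, Finset.card_univ, Fintype.card_fin, nsmul_eq_mul, mul_assoc]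

/-- **(H-bd), left**: `‖𝒢·P‖ ≤ d·(α + β)·Cst` from `|W| ≤ α`, the LIPSCHITZ bound `|W(x + e_ν) − W(x)| ≤ β/n` (`= β·η`), (1.89), the
discrete Leibniz rule and `∇ᴴ = −Sᴴ∇`: `𝒢·diag(W)∇ = (∇ᴴdiag(W̄)𝒢)ᴴ`, `∇ᴴdiag(W̄)𝒢 = −Sᴴ(diag(W̄∘τ)∇𝒢 + n·diag(W̄∘τ − W̄)𝒢)`.
[cite: Balaban1984PropagatorsI, Prop. 1.1 (1.89) p.33, (1.31) p.23] [folklore] -/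
theorem opNorm_calG_mul_firstOrder_le {W : Fin d → (Tor (fine n M) × Fin d → ℂ)} {α β : ℝ} (hα : 0 ≤ α) (hβ : 0 ≤ β)
    (hW : ∀ μ i, ‖W μ i‖ ≤ α) (hLip : ∀ μ i, ‖W μ (tau (fine n M) μ i) - W μ i‖ ≤ β / n) :
    ‖calG n hn M a ha * firstOrder (fine n M) ((n : ℕ) : ℂ) W‖ ≤ d * (α + β) * Cst d a := by
  have hnpos : (0 : ℝ) < n := by exact_mod_cast hn
  have hC := Cst_nonneg d a
  rw [firstOrder, Finset.mul_sum]
  refine (norm_sum_le _ _).trans ?_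
  set G := calG n hn M a ha with hG
  have hterm : ∀ μ ∈ Finset.univ, ‖G * (Matrix.diagonal (W μ) * fdiff (fine n M) ((n : ℕ) : ℂ) μ)‖ ≤ (α + β) * Cst d a := by
    intro μ _
    -- pass to the adjoint
    have hadj : G * (Matrix.diagonal (W μ) * fdiff (fine n M) ((n : ℕ) : ℂ) μ)
        = ((fdiff (fine n M) ((n : ℕ) : ℂ) μ)ᴴ * Matrix.diagonal (star (W μ)) * G)ᴴ := by
      rw [Matrix.conjTranspose_mul, Matrix.conjTranspose_mul, Matrix.conjTranspose_conjTranspose, Matrix.diagonal_conjTranspose,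
        star_star, hG, (calG_isHermitian n hn M a ha).eq]
    rw [hadj, Matrix.l2_opNorm_conjTranspose]
    -- `∇ᴴ = −Sᴴ∇`
    have e : ((n : ℕ) : ℂ) = ((n : ℝ) : ℂ) := by push_cast; rfl
    have hstar : (fdiff (fine n M) ((n : ℕ) : ℂ) μ)ᴴ = -((shiftM (fine n M) μ)ᴴ * fdiff (fine n M) ((n : ℕ) : ℂ) μ) := by
      have h1 := congrArg Matrix.conjTranspose (fdiff_eq_neg_conjTranspose_mul (fine n M) (n : ℝ) μ)
      rw [Matrix.conjTranspose_neg, Matrix.conjTranspose_mul, Matrix.conjTranspose_conjTranspose] at h1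
      rw [e]; exact h1
    have hform : (shiftM (fine n M) μ)ᴴ * fdiff (fine n M) ((n : ℕ) : ℂ) μ * Matrix.diagonal (star (W μ)) * G
        = (shiftM (fine n M) μ)ᴴ * (Matrix.diagonal (star (W μ) ∘ tau (fine n M) μ) * (fdiff (fine n M) ((n : ℕ) : ℂ) μ * G)
            + ((n : ℕ) : ℂ) • (Matrix.diagonal (star (W μ) ∘ tau (fine n M) μ) * G - Matrix.diagonal (star (W μ)) * G)) := by
      rw [Matrix.mul_assoc ((shiftM (fine n M) μ)ᴴ) (fdiff (fine n M) ((n : ℕ) : ℂ) μ) (Matrix.diagonal (star (W μ))),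
        fdiff_mul_diagonal, Matrix.mul_assoc, Matrix.add_mul, Matrix.smul_mul, Matrix.sub_mul, Matrix.mul_assoc]
    rw [hstar, Matrix.neg_mul, Matrix.neg_mul, norm_neg, hform]
    have hS : ‖(shiftM (fine n M) μ)ᴴ‖ ≤ 1 := by rw [Matrix.l2_opNorm_conjTranspose]; exact opNorm_shiftM_le _ μ
    -- the two pieces
    have hWt : ∀ i, ‖(star (W μ) ∘ tau (fine n M) μ) i‖ ≤ α := fun i => by
      simp only [Function.comp_apply, Pi.star_apply, norm_star]; exact hW μ _
    have hp1 : ‖Matrix.diagonal (star (W μ) ∘ tau (fine n M) μ) * (fdiff (fine n M) ((n : ℕ) : ℂ) μ * G)‖ ≤ α * Cst d a :=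
      (Matrix.l2_opNorm_mul _ _).trans (mul_le_mul (opNorm_diagonal_le _ hα hWt) (opNorm_fdiff_calG_le n hn M a ha μ)
        (norm_nonneg _) hα)
    have hdiff : ‖Matrix.diagonal (star (W μ) ∘ tau (fine n M) μ) * G - Matrix.diagonal (star (W μ)) * G‖ ≤ β / n * Cst d a := by
      rw [← Matrix.sub_mul, Matrix.diagonal_sub]
      refine (Matrix.l2_opNorm_mul _ _).trans (mul_le_mul ?_ (opNorm_calG_le n hn M a ha) (norm_nonneg _) (by positivity))
      refine opNorm_diagonal_le _ (by positivity) fun i => ?_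
      simp only [Function.comp_apply, Pi.star_apply]
      rw [← star_sub, norm_star]
      exact hLip μ i
    have hp2 : ‖((n : ℕ) : ℂ) • (Matrix.diagonal (star (W μ) ∘ tau (fine n M) μ) * G - Matrix.diagonal (star (W μ)) * G)‖
        ≤ β * Cst d a := by
      rw [norm_smul, Complex.norm_natCast]
      calc (n : ℝ) * ‖Matrix.diagonal (star (W μ) ∘ tau (fine n M) μ) * G - Matrix.diagonal (star (W μ)) * G‖
          ≤ n * (β / n * Cst d a) := mul_le_mul_of_nonneg_left hdiff hnpos.le
        _ = β * Cst d a := by field_simp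
    calc _ ≤ ‖(shiftM (fine n M) μ)ᴴ‖ * ‖Matrix.diagonal (star (W μ) ∘ tau (fine n M) μ) * (fdiff (fine n M) ((n : ℕ) : ℂ) μ * G)
            + ((n : ℕ) : ℂ) • (Matrix.diagonal (star (W μ) ∘ tau (fine n M) μ) * G - Matrix.diagonal (star (W μ)) * G)‖ :=
          Matrix.l2_opNorm_mul _ _
      _ ≤ 1 * (α * Cst d a + β * Cst d a) :=
          mul_le_mul hS ((norm_add_le _ _).trans (add_le_add hp1 hp2)) (norm_nonneg _) zero_le_one
      _ = (α + β) * Cst d a := by ring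
  refine (Finset.sum_le_sum hterm).trans (le_of_eq ?_)
  rw [Finset.sum_const, Finset.card_univ, Fintype.card_fin, nsmul_eq_mul, mul_assoc]

end Level

/-! ## §3 (H-cons) at two levels -/

section TwoLevel

variable (N R : ℕ) [NeZero N] [NeZero R] (M : Fin d → ℕ) [hM : ∀ μ, NeZero (M μ)] (a : ℝ) (ha : 0 < a)

/-- **THE EXACT TWO-LEVEL DECOMPOSITION** per direction: `D′∇′J − J D∇ = R·(D′ − D̄)·F·J·∇ + (1 − Π)·(R·F − 1)·J·D·∇` with
`D′ = diag W′`, `D = diag W`, `D̄ = diag(W ∘ parT)` (file 6: `∇′J = R·FJ∇`, `JD = D̄J`, `Π(R·F − 1)J = 0`). [folklore] -/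
theorem consistency_decomp (hd : 1 ≤ d) (hN : 1 ≤ N) (μ : Fin d) (W' : Tor (fine (R * N) M) × Fin d → ℂ)
    (W : Tor (fine N M) × Fin d → ℂ) :
    Matrix.diagonal W' * fdiff (fine (R * N) M) (((R * N : ℕ)) : ℂ) μ * JK N R M
        - JK N R M * (Matrix.diagonal W * fdiff (fine N M) ((N : ℕ) : ℂ) μ)
      = ((R : ℂ)) • ((Matrix.diagonal W' - Matrix.diagonal (W ∘ parT N R M)) * faceF N R M μ * JK N R M
            * fdiff (fine N M) ((N : ℕ) : ℂ) μ)
        + (1 - Pi N R M) * ((((R : ℂ)) • faceF N R M μ - 1) * JK N R M * Matrix.diagonal W * fdiff (fine N M) ((N : ℕ) : ℂ) μ) := by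
  have h1 : Matrix.diagonal W' * fdiff (fine (R * N) M) (((R * N : ℕ)) : ℂ) μ * JK N R M
      = ((R : ℂ)) • (Matrix.diagonal W' * (faceF N R M μ * (JK N R M * fdiff (fine N M) ((N : ℕ) : ℂ) μ))) := by
    rw [Matrix.mul_assoc, fdiff_mul_JK N R M hN μ, Matrix.mul_smul]
    simp only [Matrix.mul_assoc]
  have h2 : JK N R M * (Matrix.diagonal W * fdiff (fine N M) ((N : ℕ) : ℂ) μ)
      = Matrix.diagonal (W ∘ parT N R M) * (JK N R M * fdiff (fine N M) ((N : ℕ) : ℂ) μ) := by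
    rw [← Matrix.mul_assoc, JK_mul_diagonal, Matrix.mul_assoc]
  have h3 : (((R : ℂ)) • faceF N R M μ - 1) * JK N R M * Matrix.diagonal W
      = (((R : ℂ)) • faceF N R M μ - 1) * Matrix.diagonal (W ∘ parT N R M) * JK N R M := by
    rw [Matrix.mul_assoc, JK_mul_diagonal, ← Matrix.mul_assoc]
  have h4 : (1 - Pi N R M) * ((((R : ℂ)) • faceF N R M μ - 1) * JK N R M * Matrix.diagonal W * fdiff (fine N M) ((N : ℕ) : ℂ) μ)
      = (((R : ℂ)) • faceF N R M μ - 1) * JK N R M * Matrix.diagonal W * fdiff (fine N M) ((N : ℕ) : ℂ) μ := by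
    have e : Pi N R M * ((((R : ℂ)) • faceF N R M μ - 1) * JK N R M * Matrix.diagonal W * fdiff (fine N M) ((N : ℕ) : ℂ) μ)
        = (Pi N R M * (((R : ℂ)) • faceF N R M μ - 1) * JK N R M) * Matrix.diagonal W * fdiff (fine N M) ((N : ℕ) : ℂ) μ := by
      simp only [Matrix.mul_assoc]
    rw [Matrix.sub_mul, Matrix.one_mul, e, Pi_mul_face_defect_mul_JK N R M hd μ, Matrix.zero_mul, Matrix.zero_mul, sub_zero]
  have h5 : faceF N R M μ * Matrix.diagonal (W ∘ parT N R M) = Matrix.diagonal (W ∘ parT N R M) * faceF N R M μ := by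
    rw [faceF, Matrix.diagonal_mul_diagonal, Matrix.diagonal_mul_diagonal]
    congr 1; funext i; ring
  have h5' : ∀ Y : Matrix (Tor (fine (R * N) M) × Fin d) (Tor (fine N M) × Fin d) ℂ,
      faceF N R M μ * (Matrix.diagonal (W ∘ parT N R M) * Y) = Matrix.diagonal (W ∘ parT N R M) * (faceF N R M μ * Y) := by
    intro Y; rw [← Matrix.mul_assoc, h5, Matrix.mul_assoc]
  rw [h1, h2, h4, h3]
  simp only [Matrix.sub_mul, Matrix.one_mul, Matrix.smul_mul, smul_sub, Matrix.mul_assoc]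
  rw [h5']
  abel

/-- **(H-cons) AT TWO LEVELS**: for coefficient fields with `|W| ≤ α` (coarse) and the two-level consistency
`|W′(x′) − W(parT x′)| ≤ δ`: `‖𝒢^{(η/R)}·(P′J_R − J_RP)·𝒢^{(η)}‖ ≤ d·(R·Cst·δ·Cst + (2dCst·η)·(R + 1)·α·Cst)`. [cite:
Balaban1984PropagatorsI, Prop. 1.1 (1.89) p.33; King1986, (2.10) p.653, p.664] [folklore] -/
theorem opNorm_consistency_le (hd : 1 ≤ d) (hN : 1 ≤ N) (hRN : 1 ≤ R * N) {W' : Fin d → (Tor (fine (R * N) M) × Fin d → ℂ)}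
    {W : Fin d → (Tor (fine N M) × Fin d → ℂ)} {α δ : ℝ} (hα : 0 ≤ α) (hδ : 0 ≤ δ) (hW : ∀ μ i, ‖W μ i‖ ≤ α)
    (hcons : ∀ μ i, ‖W' μ i - W μ (parT N R M i)‖ ≤ δ) :
    ‖calG (R * N) hRN M a ha * (firstOrder (fine (R * N) M) (((R * N : ℕ)) : ℂ) W' * JK N R M
        - JK N R M * firstOrder (fine N M) ((N : ℕ) : ℂ) W) * calG N hN M a ha‖
      ≤ d * (R * Cst d a * δ * Cst d a + (2 * d * Cst d a / N) * (R + 1) * α * Cst d a) := by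
  have hC := Cst_nonneg d a
  have hNpos : (0 : ℝ) < N := by exact_mod_cast hN
  set G' := calG (R * N) hRN M a ha with hG'
  set G := calG N hN M a ha with hG
  -- split over directions
  have hsplit : firstOrder (fine (R * N) M) (((R * N : ℕ)) : ℂ) W' * JK N R M - JK N R M * firstOrder (fine N M) ((N : ℕ) : ℂ) W
      = ∑ μ, (Matrix.diagonal (W' μ) * fdiff (fine (R * N) M) (((R * N : ℕ)) : ℂ) μ * JK N R M
          - JK N R M * (Matrix.diagonal (W μ) * fdiff (fine N M) ((N : ℕ) : ℂ) μ)) := by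
    rw [firstOrder, firstOrder, Matrix.sum_mul, Matrix.mul_sum, ← Finset.sum_sub_distrib]
  rw [hsplit, Matrix.mul_sum, Matrix.sum_mul]
  refine (norm_sum_le _ _).trans ?_
  have hterm : ∀ μ ∈ Finset.univ, ‖G' * (Matrix.diagonal (W' μ) * fdiff (fine (R * N) M) (((R * N : ℕ)) : ℂ) μ * JK N R M
        - JK N R M * (Matrix.diagonal (W μ) * fdiff (fine N M) ((N : ℕ) : ℂ) μ)) * G‖
      ≤ R * Cst d a * δ * Cst d a + (2 * d * Cst d a / N) * (R + 1) * α * Cst d a := by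
    intro μ _
    rw [consistency_decomp N R M hd hN μ (W' μ) (W μ), Matrix.mul_add, Matrix.add_mul]
    refine (norm_add_le _ _).trans (add_le_add ?_ ?_)
    · -- `R • G' (D' − D̄) F J ∇ G`
      rw [Matrix.mul_smul, Matrix.smul_mul, norm_smul, Complex.norm_natCast]
      have hD : ‖Matrix.diagonal (W' μ) - Matrix.diagonal (W μ ∘ parT N R M)‖ ≤ δ := by
        rw [Matrix.diagonal_sub]; exact opNorm_diagonal_le _ hδ fun i => hcons μ i
      have e : G' * ((Matrix.diagonal (W' μ) - Matrix.diagonal (W μ ∘ parT N R M)) * faceF N R M μ * JK N R M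
            * fdiff (fine N M) ((N : ℕ) : ℂ) μ) * G
          = (G' * (Matrix.diagonal (W' μ) - Matrix.diagonal (W μ ∘ parT N R M))) * (faceF N R M μ * JK N R M)
            * (fdiff (fine N M) ((N : ℕ) : ℂ) μ * G) := by simp only [Matrix.mul_assoc]
      rw [e]
      have hA : ‖G' * (Matrix.diagonal (W' μ) - Matrix.diagonal (W μ ∘ parT N R M))‖ ≤ Cst d a * δ :=
        (Matrix.l2_opNorm_mul _ _).trans (mul_le_mul (opNorm_calG_le _ hRN M a ha) hD (norm_nonneg _) hC)
      have hB : ‖faceF N R M μ * JK N R M‖ ≤ 1 :=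
        (Matrix.l2_opNorm_mul _ _).trans ((mul_le_mul (opNorm_faceF_le N R M μ) (opNorm_JK_le N R M) (norm_nonneg _)
          zero_le_one).trans (le_of_eq (one_mul 1)))
      have hCD := opNorm_fdiff_calG_le N hN M a ha μ
      have hX : ‖G' * (Matrix.diagonal (W' μ) - Matrix.diagonal (W μ ∘ parT N R M)) * (faceF N R M μ * JK N R M)
          * (fdiff (fine N M) ((N : ℕ) : ℂ) μ * G)‖ ≤ Cst d a * δ * Cst d a := by
        calc _ ≤ ‖G' * (Matrix.diagonal (W' μ) - Matrix.diagonal (W μ ∘ parT N R M)) * (faceF N R M μ * JK N R M)‖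
                * ‖fdiff (fine N M) ((N : ℕ) : ℂ) μ * G‖ := Matrix.l2_opNorm_mul _ _
          _ ≤ (Cst d a * δ * 1) * Cst d a := by
              refine mul_le_mul ((Matrix.l2_opNorm_mul _ _).trans (mul_le_mul hA hB (norm_nonneg _) (by positivity))) hCD
                (norm_nonneg _) (by positivity)
          _ = Cst d a * δ * Cst d a := by ring
      calc (R : ℝ) * ‖G' * (Matrix.diagonal (W' μ) - Matrix.diagonal (W μ ∘ parT N R M)) * (faceF N R M μ * JK N R M)
              * (fdiff (fine N M) ((N : ℕ) : ℂ) μ * G)‖ ≤ R * (Cst d a * δ * Cst d a) :=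
            mul_le_mul_of_nonneg_left hX (Nat.cast_nonneg R)
        _ = R * Cst d a * δ * Cst d a := by ring
    · -- `G'(1 − Π) (R•F − 1) J D ∇ G`
      have e : G' * ((1 - Pi N R M) * ((((R : ℂ)) • faceF N R M μ - 1) * JK N R M * Matrix.diagonal (W μ)
            * fdiff (fine N M) ((N : ℕ) : ℂ) μ)) * G
          = (G' * (1 - JK N R M * (JK N R M)ᴴ)) * ((((R : ℂ)) • faceF N R M μ - 1) * JK N R M * Matrix.diagonal (W μ))
            * (fdiff (fine N M) ((N : ℕ) : ℂ) μ * G) := by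
        rw [JK_mul_conjTranspose]; simp only [Matrix.mul_assoc]
      rw [e]
      have hA := opNorm_calG_mul_one_sub_Pi_le N R M a ha hN hRN
      have hB : ‖(((R : ℂ)) • faceF N R M μ - 1) * JK N R M * Matrix.diagonal (W μ)‖ ≤ (R + 1) * 1 * α :=
        (Matrix.l2_opNorm_mul _ _).trans (mul_le_mul ((Matrix.l2_opNorm_mul _ _).trans (mul_le_mul
          (opNorm_face_defect_le N R M μ) (opNorm_JK_le N R M) (norm_nonneg _) (by positivity)))
          (opNorm_diagonal_le _ hα (hW μ)) (norm_nonneg _) (by positivity))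
      have hCD := opNorm_fdiff_calG_le N hN M a ha μ
      calc _ ≤ ‖G' * (1 - JK N R M * (JK N R M)ᴴ) * ((((R : ℂ)) • faceF N R M μ - 1) * JK N R M * Matrix.diagonal (W μ))‖
              * ‖fdiff (fine N M) ((N : ℕ) : ℂ) μ * G‖ := Matrix.l2_opNorm_mul _ _
        _ ≤ (2 * d * Cst d a / N * ((R + 1) * 1 * α)) * Cst d a := by
            refine mul_le_mul ((Matrix.l2_opNorm_mul _ _).trans (mul_le_mul hA hB (norm_nonneg _) (by positivity))) hCD
              (norm_nonneg _) (by positivity)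
        _ = 2 * d * Cst d a / N * (R + 1) * α * Cst d a := by ring
  refine (Finset.sum_le_sum hterm).trans (le_of_eq ?_)
  rw [Finset.sum_const, Finset.card_univ, Fintype.card_fin, nsmul_eq_mul]

end TwoLevel

/-! ## §4 Along the tower: `PerturbationLaws` discharged, the η-rate unconditional -/

section Tower

variable (L : ℕ) [NeZero L] (M : Fin d → ℕ) [hM : ∀ μ, NeZero (M μ)] (a : ℝ) (ha : 0 < a)

/-- **A LIPSCHITZ BACKGROUND SAMPLED AT EVERY SPACING**: coefficient fields `V k μ` on the lattices `L^{−k}` with (i) size `≤ α`,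
(ii) Lipschitz at their own spacing `|V(x + e_ν) − V(x)| ≤ β/L^k`, (iii) two-spacing consistency `|V^{(k+1)}(x′) − V^{(k)}(par x′)| ≤
β/L^k` — e.g. the samples of one Lipschitz connection on the unit torus.  A hypothesis on DATA (the background), not a fact.
[folklore] -/
structure LipschitzBackground (V : (k : ℕ) → Fin d → (idx L M k → ℂ)) (α β : ℝ) : Prop where
  /-- `α, β ≥ 0` -/
  nonneg : 0 ≤ α ∧ 0 ≤ β
  /-- (i) size -/
  bound : ∀ k μ i, ‖V k μ i‖ ≤ α
  /-- (ii) Lipschitz at spacing `L^{−k}` -/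
  lipschitz : ∀ k μ ν i, ‖V k μ (tau (fine (lev L k) M) ν i) - V k μ i‖ ≤ β / (lev L k : ℕ)
  /-- (iii) two-spacing consistency at the block parent -/
  consistent : ∀ k μ (i : idx L M (k + 1)), ‖V (k + 1) μ i - V k μ (parT (lev L k) L M i)‖ ≤ β / (lev L k : ℕ)

/-- the model perturbation family along the tower: `P_k = Σ_μ diag(V^{(k)}_μ)·∇^{(k)}_μ`. [folklore] -/
def Pmodel (V : (k : ℕ) → Fin d → (idx L M k → ℂ)) (k : ℕ) : Matrix (idx L M k) (idx L M k) ℂ :=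
  firstOrder (fine (lev L k) M) ((lev L k : ℕ) : ℂ) (V k)

/-- the consistency constant `C₂ = d·Cst²·(Lβ + 2d(L + 1)α)`. [folklore] -/
def C2model (d L : ℕ) (a α β : ℝ) : ℝ := d * (L * Cst d a * β * Cst d a + 2 * d * Cst d a * (L + 1) * α * Cst d a)

/-- **`PerturbationLaws` DISCHARGED for the first-order model** (`d ≥ 1`): `κ = d(α + β)Cst`, `e₂ k = C₂·L^{−k}`.
[cite: Balaban1984PropagatorsI, Prop. 1.1 (1.89) p.33; King1986, (2.10) p.653, p.664] [folklore] -/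
theorem perturbationLaws_firstOrder (hd : 1 ≤ d) {V : (k : ℕ) → Fin d → (idx L M k → ℂ)} {α β : ℝ}
    (hV : LipschitzBackground L M V α β) :
    PerturbationLaws (calDalev L M a ha) (Pmodel L M V) (JpcT L M) (d * (α + β) * Cst d a)
      (fun k => C2model d L a α β * ((L : ℝ)⁻¹) ^ k) where
  opNorm_P_mul_inv_le := fun k => by
    rw [calDalev_inv]
    have h := opNorm_firstOrder_mul_calG_le (lev L k) (one_le_lev' L k) M a ha hV.nonneg.1 (hV.bound k)
    refine h.trans ?_
    exact mul_le_mul_of_nonneg_right (mul_le_mul_of_nonneg_left (le_add_of_nonneg_right hV.nonneg.2) (Nat.cast_nonneg d))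
      (Cst_nonneg d a)
  opNorm_inv_mul_P_le := fun k => by
    rw [calDalev_inv]
    exact opNorm_calG_mul_firstOrder_le (lev L k) (one_le_lev' L k) M a ha hV.nonneg.1 hV.nonneg.2 (hV.bound k)
      (fun μ i => hV.lipschitz k μ μ i)
  consistent_le := fun k => by
    have hL1 : 1 ≤ L := Nat.pos_of_ne_zero (NeZero.ne L)
    have hLpos : (0 : ℝ) < L := by exact_mod_cast hL1
    have hlev : (0 : ℝ) < (lev L k : ℕ) := by exact_mod_cast one_le_lev' L k
    rw [calDalev_inv, calDalev_inv]
    have h := opNorm_consistency_le (lev L k) L M a ha hd (one_le_lev' L k) (one_le_lev' L (k + 1)) hV.nonneg.1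
      (div_nonneg hV.nonneg.2 hlev.le) (hV.bound k) (hV.consistent k)
    refine h.trans (le_of_eq ?_)
    rw [C2model, cast_lev', inv_pow]
    have hLk : (0 : ℝ) < (L : ℝ) ^ k := pow_pos hLpos k
    field_simp

/-- **THE FIRST BACKGROUND-DEPENDENT η-RATE** (`L ≥ 2`, `d ≥ 1`): for every Lipschitz background `V` (size `α`, Lipschitz /
consistency constant `β`) and every coupling `‖t‖·d(α + β)Cst < 1`, the King-averaged unit-lattice covariances of
`(Δ_a^{(k)} + t·Σ_μ diag(V^{(k)}_μ)∇^{(k)}_μ)⁻¹` CONVERGE as `k → ∞` with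
`‖c_k(t) − c_∞(t)‖ ≤ Cpert(t)·L^{−k}/(1 − L^{−1})`, `Cpert(t) = (CJ + ‖t‖C₂)(1 − ‖t‖κ)^{−2} + 2dCst(1 − ‖t‖κ)^{−1}`,
`κ = d(α + β)Cst`, `C₂ = d·Cst²(Lβ + 2d(L + 1)α)`.  NO typed residual.  Statement, pairing and constants OURS.
[cite: King1986, Lemma 4.5 (4.32)/(4.38) p.674; Balaban1984PropagatorsI, (1.69) p.29, (1.83) p.31, Prop. 1.1 (1.89) p.33;
Balaban1985BackgroundPropagators, (3.3) p.390 (shape of the covariant coupling)] [folklore] -/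
theorem towerLimitRate_firstOrderBackground (hL : 2 ≤ L) (hd : 1 ≤ d) {V : (k : ℕ) → Fin d → (idx L M k → ℂ)} {α β : ℝ}
    (hV : LipschitzBackground L M V α β) {t : ℂ} (ht : ‖t‖ * (d * (α + β) * Cst d a) < 1) :
    TowerLimitRate (Qlev L M) ((L : ℝ) ^ d) (fun k => (calDalev L M a ha k + t • Pmodel L M V k)⁻¹)
      (Cpert (d * (α + β) * Cst d a) (2 * d * Cst d a) (CJ d a) (C2model d L a α β) 0 t) ((L : ℝ)⁻¹) :=
  towerLimitRate_perturbed_king L M a ha hL (perturbationLaws_firstOrder L M a ha hd hV) ht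

/-- the same with the limits named and the LIPSCHITZ BOUND IN THE BACKGROUND STRENGTH:
`‖c_∞(t) − c_∞(0)‖ ≤ ‖t‖·κ·Cst·(1 − ‖t‖κ)^{−1}`. [folklore] -/
theorem firstOrderBackground_limit (hL : 2 ≤ L) (hd : 1 ≤ d) {V : (k : ℕ) → Fin d → (idx L M k → ℂ)} {α β : ℝ}
    (hV : LipschitzBackground L M V α β) {t : ℂ} (ht : ‖t‖ * (d * (α + β) * Cst d a) < 1) :
    ∃ ct c0 : Matrix (idx L M 0) (idx L M 0) ℂ,
      Tendsto (pertCov L M a ha (Pmodel L M V) t) atTop (𝓝 ct) ∧ Tendsto (pertCov L M a ha (Pmodel L M V) 0) atTop (𝓝 c0) ∧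
      (∀ k, ‖pertCov L M a ha (Pmodel L M V) t k - ct‖
          ≤ Cpert (d * (α + β) * Cst d a) (2 * d * Cst d a) (CJ d a) (C2model d L a α β) 0 t * ((L : ℝ)⁻¹) ^ k
              / (1 - (L : ℝ)⁻¹)) ∧
      ‖ct - c0‖ ≤ ‖t‖ * (d * (α + β) * Cst d a) * Cst d a * (1 - ‖t‖ * (d * (α + β) * Cst d a))⁻¹ :=
  ne2Plus_resolvent_route L M a ha hL (perturbationLaws_firstOrder L M a ha hd hV) ht

end Tower

end Summit.QuantumFields.BalabanUV.T4Continuum.FirstOrderBackgroundModel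

end
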